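import Summits.QuantumFields.YangMills.Theorems.BalabanUVNodesC44IterMhFramedAtRecord
import Summits.QuantumFields.YangMills.Theorems.BalabanUVNodesC44IterMhRegular
import Summits.QuantumFields.YangMills.Theorems.BalabanUVNodesProp4UniformAtRecordPr
import HarnessLib

/-!
# (ℓa-C) ROAD B, FRAMED EDITION (ρ-frame-min), FILE F1ᵖʳ∕F6ᵖʳ — `D C^{sl,pr}(0) = 0`, THE LOOP PROFILE OF A REGULAR BACKGROUND AS A NAMED LEMMA, THE FRAMED (ℓa-C) LETTER FROM (14),
# AND THE TWO DOORS (loop profile ∕ regular) AT node00-def-Y's `Prop4UniformPrAtRecord` — twins of ✓`…C44IterMhLinearisation` §3, ✓`…C44IterMhAtRecord` §4, ✓`…C44IterMhRegular` §2–§3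

Cell `pub-ymgap` ∕ `ym-nodeO-ideate`, porter lineage `ymgap-nodeO-port-PTB-1` (gen 9); re-press (B) of director-ym g23 №608 (ROAD WORD FINAL; C-readers behind (A2) ✓p829103, letter-readers
behind (A3) ✓p829152); `--kind proof --supports stmt-QuantumFields-27238 --as helper`; count-neutral; NEW basename, append-nothing (the frame-free files stay, USE-HELD).
[B7] = [Balaban1985Averaging]; [B11] = [Balaban1985Variational]; [I] = [Balaban1987RG1].

WHAT IS PROVED (0 def, 0 sorry, axioms standard; ns `Summit.QuantumFields.YangMills.Theorems.C44IterMh`):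
* §1 (twins of F1 ✓`hasFDerivAt_CslOfRecord_zero` ∕ `fderiv_CslOfRecord_zero` ∕ `hasDerivAt_CslOfRecord_line_zero`): ★★ `hasFDerivAt_CslprOfRecord_zero` — under the (0.4) guard of `U₀`
  below `k`, `HasFDerivAt (CslprOfRecord … 𝔥 levB) 0 0` for EVERY datum `𝔥` = def-Y's kernel guard ✓`hasFDerivAt_CslprOfRecord_zero_iff` (A2 §4) fed with F1's frame-free
  `C1Tok`; `fderiv_CslprOfRecord_zero`; `hasDerivAt_CslprOfRecord_line_zero` (the line derivative at every component, read through ✓`NegSup.continuousLinearEquiv`).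
* §2 ★ `loopProfile_of_regular` — F6's inline extraction made a NAMED frame-free lemma: from print's (14) «regular background» profile `PlaqSmall (α(L^jη_k)²) (Ū^j(U₀))`, `j < k`,
  `α·1.1·10⁷·N ≤ 1`: the (0.4) guard below `k` and the summable loop profile `ε_j = 9L²·α(L^jη_k)²` with `ε_j ≤ 1∕50`, `N·ε_j ≤ 2`, `3·10⁵·Σ_{j<k}ε_j ≤ 1∕4` (area law
  ✓`norm_loopM_coeField_sub_one_le_of_plaqSmall`, geometric sum ✓`sum_range_weightSq_le`); ★★★ `prop4LetterCPrAtRecord_of_regular` — THE FRAMED (ℓa-C) LETTER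
  `Prop4LetterCPrAtRecord … 𝔥 levB (3.2·10¹⁶·L·N) ((2·10¹¹·L·N)⁻¹)` from (14) + the top-level profile + the two DISPLAYED frame bounds (hdom)∕(hnear) of F5ᵖʳ.
* §3 the doors: ★ `prop4UniformPrAtRecord_of_letters_loopProfile` (twin of F5 §4) and ★ `prop4UniformPrAtRecord_of_letters_regular` (twin of F6 §3) — the G-door
  ✓`prop4UniformPrAtRecord_of_letters_of_norm_J_le` with the (ℓa-C)ᵖʳ slot FILLED; (ℓa-H)ᵖʳ `b`, the numbers at `(C₂, c₄) = (3.2·10¹⁶·L·N, (2·10¹¹·L·N)⁻¹)`, (ℓb), (ℓc)ᵖʳ, (ℓd)ᵖʳ,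
  `‖J‖ ≤ nJ` stay HYPOTHESES.

HONEST FRAMING.  (ℓa-C)ᵖʳ is discharged ONLY in the small-field approximation (`Ω_k = T`) and MODULO the two displayed frame bounds (hdom)∕(hnear), proved here for NO non-trivial
frame (no frame is constructed in the tree yet — (A1) `hierFrameDatumOfRecord` is node00-def-Y's); constants crude; (ℓa-H)ᵖʳ(ℓd)ᵖʳ DISPLAYED; (R1)∕(R2) OPEN; K0ᴬ ⟨stmt-QuantumFields-27238⟩
NOT closed; NODE O 0∕1; COUNT 8∕28 · K 1∕4 UNMOVED; finite `𝕋⁴_{L^K}` at fixed ε — NOT continuum ∕ ℝ⁴ ∕ OS ∕ Clay; **the Yang–Mills mass gap (Clay) is NOT proved by any of this.**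
No `sorry`, `instance`, `notation`, `set_option`; standard axioms.
-/

noncomputable section

open scoped Matrix Matrix.Norms.L2Operator InnerProductSpace ComplexConjugate Topology

namespace Summit.QuantumFields.YangMills.Theorems.C44IterMh

open Literature.MathematicalPhysics.QuantumFieldTheory.Balaban1983to89
open Literature.MathematicalPhysics.QuantumFieldTheory.Balaban1983to89.Node00
open T4Continuum BlockAveraging
open B15AveragingHolomorphic (loopMh iterMh coeField_iter_eq_iterMh)
open B11Eq115Space (NegSup NegSize levWeight)
open B11Eq103H1Complex (SiteL2K)
open ExpMeanLog (expMeanLogSU deltaSU)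
open Filter
open Summit.QuantumFields.YangMills.Theorems.Prop4UniformAtRecord (prop4UniformPrAtRecord_of_letters_of_norm_J_le)

section Record

variable (F : T4Family) (N : ℕ) [NeZero N] {K : ℕ} (k : ℕ) (Ω : ℕ → Set (Site (F.P K) 0)) (U₀ : GaugeField (F.P K) 0 (SU N))

/-! ## §1  `D C^{sl,pr}(0) = 0` for every datum (def-Y's kernel guard fed with F1) -/

/-- ★★ **`D C^{sl,pr}(0) = 0` AT THE RECORD, EVERY DATUM**: under the small-field guard of `U₀` below `k`, `HasFDerivAt (CslprOfRecord F N K k Ω U₀ 𝔥 levB) 0 0` — def-Y's kernel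
guard ✓`hasFDerivAt_CslprOfRecord_zero_iff` («framed `C1Tok` ⟺ frame-free `C1Tok`») discharged by F1 ✓`hasFDerivAt_CslOfRecord_zero`.  The framed remainder has NO linear term
((44)∕(55): «a power series expansion … begins with second order terms»). [cite: Balaban1985Variational, (44) p.285, (55)–(56) p.286, (51) p.286; Balaban1985Averaging, (92) p.31] -/
theorem hasFDerivAt_CslprOfRecord_zero [Fact (0 < (F.L : ℝ))] [Fact (0 < (F.P K).eta k)] (𝔥 : FrameDatum (F.P K) N k U₀) (levB : PBond (F.P K) k → ℕ)
    (hU₀ : SmallBelow (avOfRecord F N K) k U₀) :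
    HasFDerivAt (CslprOfRecord F N K k Ω U₀ 𝔥 levB) (0 : Space115Lit F N K k Ω U₀ →L[ℂ] NegSize (F.L : ℝ) ((F.P K).eta k) levB 0 (Matrix (Fin N) (Fin N) ℂ)) 0 :=
  (hasFDerivAt_CslprOfRecord_zero_iff F N K k Ω U₀ 𝔥 levB hU₀).2 (hasFDerivAt_CslOfRecord_zero F k Ω U₀ levB hU₀)

/-- Equivalently: `fderiv ℂ (CslprOfRecord … 𝔥 levB) 0 = 0`. [cite: Balaban1985Variational, (44) p.285, (55) p.286] -/
theorem fderiv_CslprOfRecord_zero [Fact (0 < (F.L : ℝ))] [Fact (0 < (F.P K).eta k)] (𝔥 : FrameDatum (F.P K) N k U₀) (levB : PBond (F.P K) k → ℕ)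
    (hU₀ : SmallBelow (avOfRecord F N K) k U₀) :
    fderiv ℂ (CslprOfRecord F N K k Ω U₀ 𝔥 levB) 0 = 0 :=
  (hasFDerivAt_CslprOfRecord_zero F N k Ω U₀ 𝔥 levB hU₀).fderiv

/-- **Component-wise line form**: for every `A′` and coarse bond `c`, `d∕dt|₀ C^{sl,pr}(tA′)(c) = 0` (the Fréchet statement read through the weighted-sup identification
✓`NegSup.continuousLinearEquiv`; twin of F1 ✓`hasDerivAt_CslOfRecord_line_zero`). [cite: Balaban1985Variational, (44) p.285, (51) p.286] -/
theorem hasDerivAt_CslprOfRecord_line_zero [Fact (0 < (F.L : ℝ))] [Fact (0 < (F.P K).eta k)] (𝔥 : FrameDatum (F.P K) N k U₀) (levB : PBond (F.P K) k → ℕ)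
    (hU₀ : SmallBelow (avOfRecord F N K) k U₀) (A : Space115Lit F N K k Ω U₀) (c : PBond (F.P K) k) :
    HasDerivAt (fun t : ℂ => NegSup.equiv _ _ (CslprOfRecord F N K k Ω U₀ 𝔥 levB (t • A)) c) 0 0 := by
  have hF := hasFDerivAt_CslprOfRecord_zero F N k Ω U₀ 𝔥 levB hU₀
  set E := NegSup.continuousLinearEquiv ℂ (V := Matrix (Fin N) (Fin N) ℂ) (levWeight (F.L : ℝ) ((F.P K).eta k) levB 0) with hE
  have hline : HasDerivAt (fun t : ℂ => t • A) A 0 := by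
    have h := (hasDerivAt_id (0 : ℂ)).smul_const A
    rw [one_smul] at h
    exact h
  have hEF : HasFDerivAt (fun A' => E (CslprOfRecord F N K k Ω U₀ 𝔥 levB A'))
      ((E : NegSize (F.L : ℝ) ((F.P K).eta k) levB 0 (Matrix (Fin N) (Fin N) ℂ) →L[ℂ] (PBond (F.P K) k → Matrix (Fin N) (Fin N) ℂ)).comp
        (0 : Space115Lit F N K k Ω U₀ →L[ℂ] NegSize (F.L : ℝ) ((F.P K).eta k) levB 0 (Matrix (Fin N) (Fin N) ℂ))) 0 :=
    E.hasFDerivAt.comp 0 hF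
  have hcurve := hEF.comp_hasDerivAt_of_eq (0 : ℂ) hline (zero_smul ℂ A).symm
  have hc := (hasDerivAt_pi.1 hcurve) c
  rw [ContinuousLinearMap.comp_apply, _root_.zero_apply, map_zero, Pi.zero_apply] at hc
  exact hc.congr_of_eventuallyEq (Eventually.of_forall fun t => rfl)

/-! ## §2  The loop profile of a regular background (named), and the framed (ℓa-C) letter from (14) -/

/-- ★ **THE LOOP PROFILE OF A REGULAR BACKGROUND** (F6's inline extraction, named; frame-free): if `Ū^j(U₀)` has plaquettes within `α(L^jη_k)²` of `1` for every `j < k`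
(print's (14) «regular background», tree currency `PlaqSmall`) and `α·1.1·10⁷·N ≤ 1`, then `U₀` carries the (0.4) guard below `k` (✓`smallBelow_of_plaqProfile`) and the summable
loop profile `ε_j := 9L²·α(L^jη_k)²`: `‖Ū^j(U₀)(loop) − 1‖ ≤ ε_j` (area law over the (0.4) loops, ✓`norm_loopM_coeField_sub_one_le_of_plaqSmall`, `((d+2)L)²∕4 = 9L²` at `d = 4`),
`ε_j ≤ 9α ≤ 1∕50`, `N·ε_j ≤ 2`, and `3·10⁵·Σ_{j<k} ε_j ≤ 3·10⁵·9α·144∕143 ≤ 1∕4` (geometric sum from the top, ✓`sum_range_weightSq_le`).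
[cite: Balaban1985Variational, (14) p.280, (51)–(53) p.286; Balaban1985Averaging, Proposition 3 p.36; Balaban1987RG1, (1.2) p.260] -/
theorem loopProfile_of_regular [Fact (0 < (F.L : ℝ))] [Fact (0 < (F.P K).eta k)] {α : ℝ} (hα0 : 0 ≤ α) (hα : α * (11000000 * N) ≤ 1)
    (hreg : ∀ j, j < k → PlaqSmall (α * ((F.L : ℝ) ^ j * (F.P K).eta k) ^ 2) (Averaging.iter (avOfRecord F N K) j U₀)) :
    SmallBelow (avOfRecord F N K) k U₀ ∧
    (∀ j, 0 ≤ 9 * (F.L : ℝ) ^ 2 * (α * ((F.L : ℝ) ^ j * (F.P K).eta k) ^ 2)) ∧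
    (∀ j, j < k → ∀ (c : PBond (F.P K) (j + 1)) (i : Idx (F.P K)),
      ‖loopM (coeField (Averaging.iter (avOfRecord F N K) j U₀)) c i - 1‖ ≤ 9 * (F.L : ℝ) ^ 2 * (α * ((F.L : ℝ) ^ j * (F.P K).eta k) ^ 2)) ∧
    (∀ j, j < k → 9 * (F.L : ℝ) ^ 2 * (α * ((F.L : ℝ) ^ j * (F.P K).eta k) ^ 2) ≤ 1 / 50) ∧
    (∀ j, j < k → (N : ℝ) * (9 * (F.L : ℝ) ^ 2 * (α * ((F.L : ℝ) ^ j * (F.P K).eta k) ^ 2)) ≤ 2) ∧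
    300000 * (Finset.range k).sum (fun j => 9 * (F.L : ℝ) ^ 2 * (α * ((F.L : ℝ) ^ j * (F.P K).eta k) ^ 2)) ≤ 1 / 4 := by
  -- constants and casts (verbatim F6)
  have hN1 : (1 : ℝ) ≤ N := by exact_mod_cast Nat.one_le_iff_ne_zero.2 (NeZero.ne N)
  have hL12 : (12 : ℝ) ≤ F.L := by exact_mod_cast F.hL11
  have hL1 : (1 : ℝ) ≤ F.L := by linarith
  have hη0 : 0 < (F.P K).eta k := Fact.out
  have hw1 : (F.L : ℝ) ^ k * (F.P K).eta k = 1 := L_pow_mul_eta_real F k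
  have hαs : α ≤ 1 / 11000000 := by
    rw [le_div_iff₀ (by norm_num)]
    nlinarith [mul_le_mul_of_nonneg_left hN1 (by positivity : (0 : ℝ) ≤ α * 11000000)]
  have hαN : α * N ≤ 1 / 11000000 := by
    rw [le_div_iff₀ (by norm_num)]
    linarith
  have hS : ((((F.P K).d + 2) * (F.P K).L : ℕ) : ℝ) ^ 2 / 4 = 9 * (F.L : ℝ) ^ 2 := by
    rw [T4Family.P_d, T4Family.P_L]; push_cast; ring
  -- the weights `(L^jη_k)²·L² ≤ 1` for `j < k`
  have hwj : ∀ j, j < k → (F.L : ℝ) ^ 2 * ((F.L : ℝ) ^ j * (F.P K).eta k) ^ 2 ≤ 1 := by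
    intro j hj
    have h1 : (F.L : ℝ) ^ (j + 1) * (F.P K).eta k ≤ 1 := by
      rw [← hw1]; exact mul_le_mul_of_nonneg_right (pow_le_pow_right₀ hL1 hj) hη0.le
    have h0 : 0 ≤ (F.L : ℝ) ^ (j + 1) * (F.P K).eta k := by positivity
    calc (F.L : ℝ) ^ 2 * ((F.L : ℝ) ^ j * (F.P K).eta k) ^ 2 = ((F.L : ℝ) ^ (j + 1) * (F.P K).eta k) ^ 2 := by ring
      _ ≤ 1 := pow_le_one₀ h0 h1
  have hδ0 : ∀ j, 0 ≤ α * ((F.L : ℝ) ^ j * (F.P K).eta k) ^ 2 := fun j => mul_nonneg hα0 (sq_nonneg _)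
  have hεj : ∀ j, j < k → 9 * (F.L : ℝ) ^ 2 * (α * ((F.L : ℝ) ^ j * (F.P K).eta k) ^ 2) ≤ 9 * α := by
    intro j hj
    have h := mul_le_mul_of_nonneg_left (hwj j hj) (mul_nonneg (by norm_num : (0 : ℝ) ≤ 9) hα0)
    calc 9 * (F.L : ℝ) ^ 2 * (α * ((F.L : ℝ) ^ j * (F.P K).eta k) ^ 2) = 9 * α * ((F.L : ℝ) ^ 2 * ((F.L : ℝ) ^ j * (F.P K).eta k) ^ 2) := by ring
      _ ≤ 9 * α * 1 := h
      _ = 9 * α := mul_one _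
  have hguard : ∀ j, j < k → ((((F.P K).d + 2) * (F.P K).L : ℕ) : ℝ) ^ 2 / 4 * (α * ((F.L : ℝ) ^ j * (F.P K).eta k) ^ 2) < deltaSU (Fin N) := by
    intro j hj
    rw [hS, ExpMeanLog.deltaSU, Fintype.card_fin]
    refine lt_of_le_of_lt (hεj j hj) (lt_min (by linarith) ?_)
    rw [lt_div_iff₀ (by positivity)]
    nlinarith [Real.pi_gt_three]
  have hsum : (Finset.range k).sum (fun j => 9 * (F.L : ℝ) ^ 2 * (α * ((F.L : ℝ) ^ j * (F.P K).eta k) ^ 2)) ≤ 9 * α * (144 / 143) := by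
    have hterm : ∀ j, 9 * (F.L : ℝ) ^ 2 * (α * ((F.L : ℝ) ^ j * (F.P K).eta k) ^ 2) = 9 * α * ((F.L : ℝ) ^ 2 * ((F.L : ℝ) ^ j * (F.P K).eta k) ^ 2) := by
      intro j; ring
    simp_rw [hterm]
    rw [← Finset.mul_sum]
    have hpos : 0 < (F.L : ℝ) ^ 2 - 1 := by nlinarith
    have hratio : (F.L : ℝ) ^ 2 / ((F.L : ℝ) ^ 2 - 1) ≤ 144 / 143 := by
      rw [div_le_div_iff₀ hpos (by norm_num)]
      nlinarith
    exact mul_le_mul_of_nonneg_left ((sum_range_weightSq_le F k).trans hratio) (mul_nonneg (by norm_num) hα0)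
  refine ⟨smallBelow_of_plaqProfile (avOfRecord F N K) k U₀ hδ0 hreg hguard, fun j => mul_nonneg (by positivity) (hδ0 j), fun j hj c i => ?_,
    fun j hj => (hεj j hj).trans (by linarith), fun j hj => ?_, by linarith⟩
  · have h := norm_loopM_coeField_sub_one_le_of_plaqSmall (hδ0 j) (hreg j hj) c i
    rw [hS] at h
    exact h
  · calc (N : ℝ) * (9 * (F.L : ℝ) ^ 2 * (α * ((F.L : ℝ) ^ j * (F.P K).eta k) ^ 2)) ≤ N * (9 * α) := mul_le_mul_of_nonneg_left (hεj j hj) (by positivity)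
      _ = 9 * (α * N) := by ring
      _ ≤ 2 := by linarith

/-- ★★★ **THE FRAMED (ℓa-C) LETTER FROM (14) + THE TOP-LEVEL PROFILE + THE TWO DISPLAYED FRAME BOUNDS**: `Prop4LetterCPrAtRecord … 𝔥 levB (3.2·10¹⁶·L·N) ((2·10¹¹·L·N)⁻¹)` for every
datum `𝔥` whose window contains the traceless scaled polydisc `L^k‖Y‖ < (2.5·10¹⁰·L·N)⁻¹` (hdom) and whose frame and inverse frame are within `c_𝔥·L^k‖Y‖` of `1` there, `c_𝔥 ≤ 10³`
(hnear) — F6's regular-background door with F5ᵖʳ ✓`prop4LetterCPrAtRecord_of_loopProfile` in place of F5 (twin of ✓`prop4LetterCAtRecord_of_regular`).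
[cite: Balaban1985Variational, (14) p.280, (44) p.285, Prop. 4 (97)–(98) pp.292–293; Balaban1985Averaging, (92) p.31, Proposition 3 p.36; Balaban1987RG1, (0.8) p.253] -/
theorem prop4LetterCPrAtRecord_of_regular [Fact (0 < (F.L : ℝ))] [Fact (0 < (F.P K).eta k)] [Fact (0 < c0Rec F K k)] [Fact (∀ c, 0 < wBRec F K k c)]
    (𝔥 : FrameDatum (F.P K) N k U₀) (levB : PBond (F.P K) k → ℕ) (hΩ : ∀ x, x ∈ Ω k) {α : ℝ} (hα0 : 0 ≤ α) (hα : α * (11000000 * N) ≤ 1)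
    (hreg : ∀ j, j < k → PlaqSmall (α * ((F.L : ℝ) ^ j * (F.P K).eta k) ^ 2) (Averaging.iter (avOfRecord F N K) j U₀))
    {c𝔥 : ℝ} (hc : c𝔥 ≤ 1000)
    (hdom : ∀ Y : PBond (F.P K) 0 → Matrix (Fin N) (Fin N) ℂ, (∀ b, (Y b).trace = 0) → (F.L : ℝ) ^ k * ‖Y‖ < 1 / (25000000000 * (F.L : ℝ) * N) →
      expOver U₀ Y ∈ 𝔥.dom)
    (hnear : ∀ Y : PBond (F.P K) 0 → Matrix (Fin N) (Fin N) ℂ, (∀ b, (Y b).trace = 0) → (F.L : ℝ) ^ k * ‖Y‖ < 1 / (25000000000 * (F.L : ℝ) * N) →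
      ∀ y : Site (F.P K) k, ‖𝔥.map (expOver U₀ Y) y - 1‖ ≤ c𝔥 * ((F.L : ℝ) ^ k * ‖Y‖) ∧ ‖𝔥.inv (expOver U₀ Y) y - 1‖ ≤ c𝔥 * ((F.L : ℝ) ^ k * ‖Y‖)) :
    Prop4LetterCPrAtRecord F N K k Ω U₀ 𝔥 levB (32000000000000000 * (F.L : ℝ) * N) (1 / (200000000000 * (F.L : ℝ) * N)) := by
  obtain ⟨hU₀, hε0, hε, hε50, hNε, hεsum⟩ := loopProfile_of_regular F N k U₀ hα0 hα hreg
  exact prop4LetterCPrAtRecord_of_loopProfile F N k Ω U₀ 𝔥 levB hU₀ hΩ _ hε0 hε hε50 hNε hεsum hc hdom hnear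

/-! ## §3  Through the framed door with the (ℓa-C)ᵖʳ slot filled -/

/-- ★ **THE FRAMED PROP. 4 AT THE RECORD WITH THE (ℓa-C)ᵖʳ SLOT FILLED, LOOP-PROFILE EDITION** (twin of F5 §4 ✓`prop4UniformAtRecord_of_letters_loopProfile`): the G-door
✓`prop4UniformPrAtRecord_of_letters_of_norm_J_le` with `hC := prop4LetterCPrAtRecord_of_loopProfile`; the remaining letters stay HYPOTHESES. Glue; no new estimate.
[cite: Balaban1985Variational, Prop. 4 (97)–(98) pp.292–293, (44) p.285] -/
theorem prop4UniformPrAtRecord_of_letters_loopProfile [Fact (0 < (F.L : ℝ))] [Fact (0 < (F.P K).eta k)] [Fact (0 < c0Rec F K k)] [Fact (∀ c, 0 < wBRec F K k c)]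
    (𝔥 : FrameDatum (F.P K) N k U₀) (levB : PBond (F.P K) k → ℕ) (a : ℝ)
    (hpos : ∀ x, x ≠ 0 → 0 < RCLike.re ⟪x, laplaceAOfRecord F N k U₀ (QprOfRecord F N k U₀ 𝔥) (QprimeOfRecord F N k U₀) a x⟫_ℂ)
    (hQ : Function.Surjective (QprOfRecord F N k U₀ 𝔥)) {εC : ℝ}
    (Gp : SiteL2K ℂ (F.P K).d (fun _ => (F.P K).sitesPerDir 0) (c0Rec F K k) (WRec N) →ₗ[ℂ]
      SiteL2K ℂ (F.P K).d (fun _ => (F.P K).sitesPerDir 0) (c0Rec F K k) (WRec N))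
    {b aC CV RV R' θ₃ θE θE' N₁ nJ : ℝ}
    (hU₀ : SmallBelow (avOfRecord F N K) k U₀) (hΩ : ∀ x, x ∈ Ω k) (εs : ℕ → ℝ) (hε0 : ∀ j, 0 ≤ εs j)
    (hε : ∀ j, j < k → ∀ (c : PBond (F.P K) (j + 1)) (i : Idx (F.P K)), ‖loopM (coeField (Averaging.iter (avOfRecord F N K) j U₀)) c i - 1‖ ≤ εs j)
    (hε50 : ∀ j, j < k → εs j ≤ 1 / 50) (hNε : ∀ j, j < k → (N : ℝ) * εs j ≤ 2) (hεsum : 300000 * (Finset.range k).sum εs ≤ 1 / 4)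
    {c𝔥 : ℝ} (hc : c𝔥 ≤ 1000)
    (hdom : ∀ Y : PBond (F.P K) 0 → Matrix (Fin N) (Fin N) ℂ, (∀ b, (Y b).trace = 0) → (F.L : ℝ) ^ k * ‖Y‖ < 1 / (25000000000 * (F.L : ℝ) * N) →
      expOver U₀ Y ∈ 𝔥.dom)
    (hnear : ∀ Y : PBond (F.P K) 0 → Matrix (Fin N) (Fin N) ℂ, (∀ b, (Y b).trace = 0) → (F.L : ℝ) ^ k * ‖Y‖ < 1 / (25000000000 * (F.L : ℝ) * N) →
      ∀ y : Site (F.P K) k, ‖𝔥.map (expOver U₀ Y) y - 1‖ ≤ c𝔥 * ((F.L : ℝ) ^ k * ‖Y‖) ∧ ‖𝔥.inv (expOver U₀ Y) y - 1‖ ≤ c𝔥 * ((F.L : ℝ) ^ k * ‖Y‖))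
    (hH : Prop4LetterHPrAtRecord F N K k Ω U₀ 𝔥 levB a hpos hQ b)
    (hnum : Prop4LetterNum b (32000000000000000 * (F.L : ℝ) * N) (1 / (200000000000 * (F.L : ℝ) * N)) aC εC RV R')
    (hV : Prop4LetterV0AtRecord F N K k Ω U₀ CV RV) (hsym : Prop4LetterSymmPrAtRecord F N K k Ω U₀ Gp)
    (hcol : Prop4LetterColumnsPrAtRecord F N K k Ω U₀ 𝔥 levB a hpos hQ εC Gp R' θ₃ θE θE' N₁) (hJ : ‖JOfRecordAtBg F N K k Ω U₀‖ ≤ nJ) :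
    Prop4UniformPrAtRecord F N K k Ω U₀ 𝔥 levB a hpos hQ εC Gp (c4OfRecord N nJ b (32000000000000000 * (F.L : ℝ) * N) εC aC CV R' θ₃ θE θE' N₁) R' :=
  prop4UniformPrAtRecord_of_letters_of_norm_J_le F N K k Ω U₀ 𝔥 levB a hpos hQ Gp hH
    (prop4LetterCPrAtRecord_of_loopProfile F N k Ω U₀ 𝔥 levB hU₀ hΩ εs hε0 hε hε50 hNε hεsum hc hdom hnear) hnum hV hsym hcol hJ

/-- ★ **THE FRAMED PROP. 4 AT THE RECORD WITH THE (ℓa-C)ᵖʳ SLOT FILLED FROM (14)** (twin of F6 §3 ✓`prop4UniformAtRecord_of_letters_regular`): the G-door with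
`hC := prop4LetterCPrAtRecord_of_regular`. Glue; no new estimate. [cite: Balaban1985Variational, (14) p.280, Prop. 4 (97)–(98) pp.292–293] -/
theorem prop4UniformPrAtRecord_of_letters_regular [Fact (0 < (F.L : ℝ))] [Fact (0 < (F.P K).eta k)] [Fact (0 < c0Rec F K k)] [Fact (∀ c, 0 < wBRec F K k c)]
    (𝔥 : FrameDatum (F.P K) N k U₀) (levB : PBond (F.P K) k → ℕ) (a : ℝ)
    (hpos : ∀ x, x ≠ 0 → 0 < RCLike.re ⟪x, laplaceAOfRecord F N k U₀ (QprOfRecord F N k U₀ 𝔥) (QprimeOfRecord F N k U₀) a x⟫_ℂ)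
    (hQ : Function.Surjective (QprOfRecord F N k U₀ 𝔥)) {εC : ℝ}
    (Gp : SiteL2K ℂ (F.P K).d (fun _ => (F.P K).sitesPerDir 0) (c0Rec F K k) (WRec N) →ₗ[ℂ]
      SiteL2K ℂ (F.P K).d (fun _ => (F.P K).sitesPerDir 0) (c0Rec F K k) (WRec N))
    {b aC CV RV R' θ₃ θE θE' N₁ nJ : ℝ}
    (hΩ : ∀ x, x ∈ Ω k) {α : ℝ} (hα0 : 0 ≤ α) (hα : α * (11000000 * N) ≤ 1)
    (hreg : ∀ j, j < k → PlaqSmall (α * ((F.L : ℝ) ^ j * (F.P K).eta k) ^ 2) (Averaging.iter (avOfRecord F N K) j U₀))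
    {c𝔥 : ℝ} (hc : c𝔥 ≤ 1000)
    (hdom : ∀ Y : PBond (F.P K) 0 → Matrix (Fin N) (Fin N) ℂ, (∀ b, (Y b).trace = 0) → (F.L : ℝ) ^ k * ‖Y‖ < 1 / (25000000000 * (F.L : ℝ) * N) →
      expOver U₀ Y ∈ 𝔥.dom)
    (hnear : ∀ Y : PBond (F.P K) 0 → Matrix (Fin N) (Fin N) ℂ, (∀ b, (Y b).trace = 0) → (F.L : ℝ) ^ k * ‖Y‖ < 1 / (25000000000 * (F.L : ℝ) * N) →
      ∀ y : Site (F.P K) k, ‖𝔥.map (expOver U₀ Y) y - 1‖ ≤ c𝔥 * ((F.L : ℝ) ^ k * ‖Y‖) ∧ ‖𝔥.inv (expOver U₀ Y) y - 1‖ ≤ c𝔥 * ((F.L : ℝ) ^ k * ‖Y‖))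
    (hH : Prop4LetterHPrAtRecord F N K k Ω U₀ 𝔥 levB a hpos hQ b)
    (hnum : Prop4LetterNum b (32000000000000000 * (F.L : ℝ) * N) (1 / (200000000000 * (F.L : ℝ) * N)) aC εC RV R')
    (hV : Prop4LetterV0AtRecord F N K k Ω U₀ CV RV) (hsym : Prop4LetterSymmPrAtRecord F N K k Ω U₀ Gp)
    (hcol : Prop4LetterColumnsPrAtRecord F N K k Ω U₀ 𝔥 levB a hpos hQ εC Gp R' θ₃ θE θE' N₁) (hJ : ‖JOfRecordAtBg F N K k Ω U₀‖ ≤ nJ) :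
    Prop4UniformPrAtRecord F N K k Ω U₀ 𝔥 levB a hpos hQ εC Gp (c4OfRecord N nJ b (32000000000000000 * (F.L : ℝ) * N) εC aC CV R' θ₃ θE θE' N₁) R' :=
  prop4UniformPrAtRecord_of_letters_of_norm_J_le F N K k Ω U₀ 𝔥 levB a hpos hQ Gp hH
    (prop4LetterCPrAtRecord_of_regular F N k Ω U₀ 𝔥 levB hΩ hα0 hα hreg hc hdom hnear) hnum hV hsym hcol hJ

end Record

end Summit.QuantumFields.YangMills.Theorems.C44IterMh

end
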